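import Summits.KontsevichZagierPeriods.KontsevichZagierPeriods.Theorems.SoloInformedCornerCfg
import Summits.KontsevichZagierPeriods.KontsevichZagierPeriods.Theorems.SoloInformedAnNuPole
import Summits.KontsevichZagierPeriods.KontsevichZagierPeriods.Theorems.SoloInformedAlgCross
import HarnessLib

/-!
# The leaves of the vertex recursion at a corner configuration

Solo programme `solo-KontsevichZagierPeriods-informed`, session s111, step (γ-11) of the kernel
project PRES-RAT(2).

For a corner configuration `(F, D, Ω)` (file `SoloInformedCornerCfg`) and an integrand `P/D` we
record the *leaves* of the vertex recursion, i.e. the cases settled without blowing up: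

* every point `p ≠ 0` of the closed square (exterior point, point off `Z(F)`, or smooth point of
  `Z(F)` off the poles, by the punctured smoothness invariant);
* the corner `0` when `mult₀ F = 1` and `D(0) ≠ 0` (a smooth point);
* the corner `0` when all zeros of `F` near `0` in the open square lie outside `closure Ω`
  (then near `0` the open square is on one side of `Ω`): the **topological leaf**;
* the analytic input for the latter: if `mult₀ F = 1` and the polar order along the branch of `F`
  through `0` is `κ♯(F, D) = ⊤`, then `D` vanishes on `Z(F)` near `0` (uniqueness in the implicit
  function theorem), which the invariant forbids on `closure Ω ∖ {0}`.

References: Kontsevich–Zagier, *Periods* (2001), §1.2.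
-/

noncomputable section

open scoped BigOperators Topology
open MeasureTheory Set Filter Metric
open Literature.NumberTheory.Transcendental Literature.NumberTheory.Transcendental.KZ
open Literature.ModelTheory.ExponentialFields (IsSemialgebraic)

namespace Summit.KontsevichZagierPeriods.KontsevichZagierPeriods.Theorems

variable {K : Type*} [Field K] [Algebra K ℝ]

/-- `aeval z Q = Q(z₀, z₁)`. -/
theorem soloInformed_aeval_eq_evalR_pair (Q : MvPolynomial (Fin 2) K) (z : Fin 2 → ℝ) :
    (MvPolynomial.aeval z Q : ℝ) = soloInformedEvalR Q (z 0, z 1) := by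
  have hz : (![z 0, z 1] : Fin 2 → ℝ) = z := by
    funext i
    fin_cases i <;> rfl
  show (MvPolynomial.aeval z Q : ℝ) = MvPolynomial.aeval ![z 0, z 1] Q
  rw [hz]

/-! ### The polar order `κ♯ = ⊤` forces `D = 0` on `Z(F)` near the corner -/

/-- **`κ♯ = ⊤` means `D` vanishes on the zero set of `F` near `0`** (`mult₀ F = 1`, tangent not
vertical): by uniqueness in the implicit function theorem the zeros of `F` near `0` form the
graph of the contact branch `φ`, along which `D` vanishes identically. [this work] -/
theorem soloInformed_aeval_eq_zero_of_kappaDK_top {F D : MvPolynomial (Fin 2) K}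
    (hmult : soloInformedMultK F = 1)
    (hc : MvPolynomial.coeff (Finsupp.single 1 1) F ≠ 0) (htop : soloInformedKappaDK F D = ⊤) :
    ∃ ε > 0, ∀ z : Fin 2 → ℝ, dist z 0 < ε → (MvPolynomial.aeval z F : ℝ) = 0 →
      (MvPolynomial.aeval z D : ℝ) = 0 := by
  have hmax : soloInformedMaxContactK F = F := by
    rw [soloInformed_maxContactK_eq (k := 0) hmult]; rfl
  have H : SoloInformedContactOK F := soloInformed_contactOK_of_coeff (by rwa [hmax])
  have h0 : soloInformedEvalR (soloInformedMaxContactK F) ((0 : ℝ), (0 : ℝ)) = 0 :=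
    soloInformed_evalR_maxContactK_zero (k := 0) hmult
  have huniq := (soloInformed_contDiffAt_maxContactK F).eventually_apply_eq_iff_implicitFunction
    Literature.Analysis.Calculus.omega_ne_zero H
  have hD : ∀ᶠ x in 𝓝 (0 : ℝ), soloInformedEvalR D (x, soloInformedContactCurveK F H x) = 0 := by
    have h := htop
    unfold soloInformedKappaDK at h
    rw [dif_pos H] at h
    exact analyticOrderAt_eq_top.1 h
  have ht2 : Tendsto (fun z : Fin 2 → ℝ => (z 0, z 1)) (𝓝 0) (𝓝 ((0 : ℝ), (0 : ℝ))) := by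
    have hcont : Continuous (fun z : Fin 2 → ℝ => (z 0, z 1)) := by fun_prop
    simpa using hcont.tendsto 0
  have ht1 : Tendsto (fun z : Fin 2 → ℝ => z 0) (𝓝 0) (𝓝 0) := by
    simpa using (continuous_apply 0).tendsto (0 : Fin 2 → ℝ)
  have hev : ∀ᶠ z in 𝓝 (0 : Fin 2 → ℝ), (soloInformedEvalR F (z 0, z 1) = 0 →
      soloInformedContactCurveK F H (z 0) = z 1) ∧
      soloInformedEvalR D (z 0, soloInformedContactCurveK F H (z 0)) = 0 := by
    filter_upwards [ht2.eventually huniq, ht1.eventually hD] with z h1 h2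
    exact ⟨fun hz => h1.1 (by rw [h0, hmax]; exact hz), h2⟩
  obtain ⟨ε, hε, hball⟩ := Metric.eventually_nhds_iff.1 hev
  refine ⟨ε, hε, fun z hz hFz => ?_⟩
  obtain ⟨h1, h2⟩ := hball hz
  rw [soloInformed_aeval_eq_evalR_pair] at hFz ⊢
  rw [← h1 hFz]
  exact h2

/-- The same with the roles of the coordinates exchanged (tangent not horizontal, polar order along
the branch measured in the swapped frame). [this work] -/
theorem soloInformed_aeval_eq_zero_of_kappaDK_swapK_top {F D : MvPolynomial (Fin 2) K}
    (hmult : soloInformedMultK F = 1)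
    (hc : MvPolynomial.coeff (Finsupp.single 0 1) F ≠ 0)
    (htop : soloInformedKappaDK (soloInformedSwapK F) (soloInformedSwapK D) = ⊤) :
    ∃ ε > 0, ∀ z : Fin 2 → ℝ, dist z 0 < ε → (MvPolynomial.aeval z F : ℝ) = 0 →
      (MvPolynomial.aeval z D : ℝ) = 0 := by
  have hc' : MvPolynomial.coeff (Finsupp.single 1 1) (soloInformedSwapK F) ≠ 0 := by
    have h := soloInformed_coeff_swapK F 0 1
    rw [Finsupp.single_zero, zero_add, Finsupp.single_zero, add_zero] at h
    rwa [h]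
  obtain ⟨ε, hε, hball⟩ := soloInformed_aeval_eq_zero_of_kappaDK_top
    ((soloInformed_multK_swapK F).trans hmult) hc' htop
  refine ⟨ε, hε, fun z hz hFz => ?_⟩
  have hsw : (![(![z 1, z 0] : Fin 2 → ℝ) 1, (![z 1, z 0] : Fin 2 → ℝ) 0] : Fin 2 → ℝ) = z := by
    funext i; fin_cases i <;> rfl
  have hz' : dist (![z 1, z 0] : Fin 2 → ℝ) 0 < ε := by
    have h := soloInformed_dist_swap_lt hε hz
    rwa [Pi.zero_apply, Pi.zero_apply, soloInformed_vec_zero_zero] at h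
  have h := hball _ hz' (by rw [soloInformed_aeval_swapK, hsw]; exact hFz)
  rwa [soloInformed_aeval_swapK, hsw] at h

/-! ### The topological leaf -/

/-- **Topological leaf at the corner.**  If every zero of `F` in the open square within distance
`ε` of `0` lies outside `closure Ω`, then any `P/Q` is locally presentable on `Ω` at `0`: the
convex set `B(0, ε) ∩ (0,1)²` misses `∂Ω`, hence lies inside `Ω` (full cells) or is disjoint from
it (empty pieces). [this work] -/
theorem soloInformed_locPresOn_zero_of_zeros_not_mem_closure
    (hK : ∀ c : K, IsAlgebraic ℚ (algebraMap K ℝ c)) (hKrc : SoloInformedRealRootClosed K)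
    (P Q : MvPolynomial (Fin 2) K) {F : MvPolynomial (Fin 2) K} {Ω : Set (Fin 2 → ℝ)}
    (hΩo : IsOpen Ω) (hΩc : Ω ⊆ soloInformedOpenCube 2)
    (hfr : ∀ z ∈ soloInformedOpenCube 2, z ∈ frontier Ω → (MvPolynomial.aeval z F : ℝ) = 0)
    {ε : ℝ} (hε : 0 < ε)
    (hZ : ∀ z ∈ soloInformedOpenCube 2, dist z 0 < ε → (MvPolynomial.aeval z F : ℝ) = 0 →
      z ∉ closure Ω) :
    SoloInformedLocPresOn Ω (fun x => (MvPolynomial.aeval x P : ℝ) / MvPolynomial.aeval x Q) 0 := by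
  set W := ball (0 : Fin 2 → ℝ) ε ∩ soloInformedOpenCube 2 with hW
  have hWc : IsPreconnected W :=
    ((convex_ball _ _).inter (soloInformed_convex_openCube 2)).isPreconnected
  have hdisj : Disjoint W (frontier Ω) := by
    refine Set.disjoint_left.2 fun z hz hzf => ?_
    exact hZ z hz.2 (mem_ball.1 hz.1) (hfr z hz.2 hzf) (frontier_subset_closure hzf)
  rcases soloInformed_subset_or_disjoint_of_frontier hWc hΩo hdisj with hsub | hdis
  · exact soloInformed_locPresOn_of_ball_inter_openCube_subset hK hKrc P Q hΩc hε hsub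
  · refine soloInformed_locPresOn_of_disjoint hε (Set.disjoint_left.2 fun z hz hzΩ => ?_)
    exact (Set.disjoint_left.1 hdis) ⟨hz, hΩc hzΩ⟩ hzΩ

/-- **Topological leaf from `κ♯ = ⊤`.**  For a corner configuration with `mult₀ F = 1`, if the
polar order along the branch of `F` through `0` is `⊤` (in the frame in which the tangent is not
vertical), then `P/D` is locally presentable on `Ω` at `0`. [this work] -/
theorem soloInformed_locPresOn_zero_of_kappaDK_top
    (hK : ∀ c : K, IsAlgebraic ℚ (algebraMap K ℝ c)) (hKrc : SoloInformedRealRootClosed K)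
    {F D : MvPolynomial (Fin 2) K} {Ω : Set (Fin 2 → ℝ)} (h : SoloInformedCornerCfg F D Ω)
    (P : MvPolynomial (Fin 2) K) (hmult : soloInformedMultK F = 1)
    (htop : (MvPolynomial.coeff (Finsupp.single 1 1) F ≠ 0 ∧ soloInformedKappaDK F D = ⊤) ∨
      (MvPolynomial.coeff (Finsupp.single 0 1) F ≠ 0 ∧
        soloInformedKappaDK (soloInformedSwapK F) (soloInformedSwapK D) = ⊤)) :
    SoloInformedLocPresOn Ω (fun x => (MvPolynomial.aeval x P : ℝ) / MvPolynomial.aeval x D) 0 := by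
  obtain ⟨ε, hε, hball⟩ : ∃ ε > 0, ∀ z : Fin 2 → ℝ, dist z 0 < ε →
      (MvPolynomial.aeval z F : ℝ) = 0 → (MvPolynomial.aeval z D : ℝ) = 0 := by
    rcases htop with ⟨hc, ht⟩ | ⟨hc, ht⟩
    · exact soloInformed_aeval_eq_zero_of_kappaDK_top hmult hc ht
    · exact soloInformed_aeval_eq_zero_of_kappaDK_swapK_top hmult hc ht
  refine soloInformed_locPresOn_zero_of_zeros_not_mem_closure hK hKrc P D h.isOpen h.subset
    h.frontier hε fun z hz hzd hFz hzcl => ?_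
  have hz0 : z ≠ 0 := by
    intro hz0
    have h1 : 0 < z 0 ∧ z 0 < 1 := by simpa using hz 0
    rw [hz0] at h1
    exact lt_irrefl _ h1.1
  exact (h.invB z (soloInformedOpenCube_subset_cube 2 hz) hz0 hzcl hFz).2 (hball z hzd hFz)

/-! ### Leaves away from the corner, and the smooth corner -/

section Smooth

variable [CharZero K]

/-- **Every point `p ≠ 0` of the closed square is a leaf** of a corner configuration: exterior
points, closure points off `Z(F)`, and (by the punctured smoothness invariant) smooth points of
`Z(F)` off the poles of `P/D`. [this work] -/
theorem soloInformed_locPresOn_of_cornerCfg_ne_zero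
    (hK : ∀ c : K, IsAlgebraic ℚ (algebraMap K ℝ c)) (hKrc : SoloInformedRealRootClosed K)
    {F D : MvPolynomial (Fin 2) K} {Ω : Set (Fin 2 → ℝ)} (h : SoloInformedCornerCfg F D Ω)
    (P : MvPolynomial (Fin 2) K) {p : Fin 2 → ℝ} (hp : p ∈ soloInformedCube 2) (hp0 : p ≠ 0) :
    SoloInformedLocPresOn Ω (fun x => (MvPolynomial.aeval x P : ℝ) / MvPolynomial.aeval x D) p := by
  by_cases hcl : p ∈ closure Ω
  · by_cases hF : (MvPolynomial.aeval p F : ℝ) = 0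
    · obtain ⟨hgrad, hDp⟩ := h.invB p hp hp0 hcl hF
      exact soloInformed_locPresOn_smooth hK hKrc P D F h.isOpen h.isSemialgebraic one_pos
        (fun z hz _ hzf => h.frontier z hz hzf) hF hgrad hDp
    · exact soloInformed_locPresOn_of_aeval_ne hK hKrc P D F h.isOpen h.subset h.frontier hcl hF
  · exact soloInformed_locPresOn_of_not_mem_closure hcl

omit [Algebra K ℝ] [CharZero K] in
/-- For `mult₀ F = 1` one of the linear coefficients of `F` is non-zero. [this work] -/
theorem soloInformed_coeff_single_ne_zero_of_multK_one {F : MvPolynomial (Fin 2) K}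
    (hmult : soloInformedMultK F = 1) :
    MvPolynomial.coeff (Finsupp.single 0 1) F ≠ 0 ∨ MvPolynomial.coeff (Finsupp.single 1 1) F ≠ 0 := by
  have hF : F ≠ 0 := by
    rintro rfl
    simp [soloInformedMultK] at hmult
  obtain ⟨a, ha, hdeg⟩ := soloInformed_exists_deg_eq_multK hF
  rw [hmult] at hdeg
  have ha' : a = Finsupp.single 0 (a 0) + Finsupp.single 1 (a 1) := by
    ext i
    fin_cases i <;> simp
  rcases Nat.eq_zero_or_pos (a 0) with h0 | h0
  · right
    have h1 : a 1 = 1 := by omega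
    rw [h0, h1, Finsupp.single_zero, zero_add] at ha'
    rw [← ha']; exact MvPolynomial.mem_support_iff.1 ha
  · left
    have h0' : a 0 = 1 := by omega
    have h1 : a 1 = 0 := by omega
    rw [h0', h1, Finsupp.single_zero, add_zero] at ha'
    rw [← ha']; exact MvPolynomial.mem_support_iff.1 ha

omit [CharZero K] in
/-- The value of `∂ᵢ Q` at the corner `0 ∈ ℝ²`. -/
theorem soloInformed_aeval_zero_pderiv (Q : MvPolynomial (Fin 2) K) (i : Fin 2) :
    (MvPolynomial.aeval (0 : Fin 2 → ℝ) (MvPolynomial.pderiv i Q) : ℝ) =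
      algebraMap K ℝ (MvPolynomial.coeff (Finsupp.single i 1) Q) := by
  rw [soloInformed_aeval_eq_evalR_pair, Pi.zero_apply, ← soloInformed_evalR_pderiv_zero Q i]
  rfl

omit [CharZero K] in
/-- `F(0) = 0` when `mult₀ F = k + 1`. -/
theorem soloInformed_aeval_zero_of_multK_succ {F : MvPolynomial (Fin 2) K} {k : ℕ}
    (hmult : soloInformedMultK F = k + 1) : (MvPolynomial.aeval (0 : Fin 2 → ℝ) F : ℝ) = 0 := by
  rw [soloInformed_aevalK_zero]
  have h := soloInformed_coeff_zero_iterate_pderiv (k := 0)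
    (fun a ha => (by have := soloInformed_le_deg_of_multK_eq hmult a ha; omega))
    (P := F)
  rw [Function.iterate_zero_apply] at h
  rw [h, map_zero]

/-- **The smooth corner.**  If `mult₀ F = 1` and `D(0) ≠ 0`, the corner is a smooth point of
`Z(F)` off the poles, and `P/D` is locally presentable there. [this work] -/
theorem soloInformed_locPresOn_zero_of_multK_one
    (hK : ∀ c : K, IsAlgebraic ℚ (algebraMap K ℝ c)) (hKrc : SoloInformedRealRootClosed K)
    {F D : MvPolynomial (Fin 2) K} {Ω : Set (Fin 2 → ℝ)} (h : SoloInformedCornerCfg F D Ω)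
    (P : MvPolynomial (Fin 2) K) (hmult : soloInformedMultK F = 1)
    (hD : (MvPolynomial.aeval (0 : Fin 2 → ℝ) D : ℝ) ≠ 0) :
    SoloInformedLocPresOn Ω (fun x => (MvPolynomial.aeval x P : ℝ) / MvPolynomial.aeval x D) 0 := by
  have e : Function.Injective (algebraMap K ℝ) := (algebraMap K ℝ).injective
  have hF0 : (MvPolynomial.aeval (0 : Fin 2 → ℝ) F : ℝ) = 0 :=
    soloInformed_aeval_zero_of_multK_succ (k := 0) hmult
  have hgrad : (MvPolynomial.aeval (0 : Fin 2 → ℝ) (MvPolynomial.pderiv 0 F) : ℝ) ≠ 0 ∨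
      (MvPolynomial.aeval (0 : Fin 2 → ℝ) (MvPolynomial.pderiv 1 F) : ℝ) ≠ 0 := by
    rcases soloInformed_coeff_single_ne_zero_of_multK_one hmult with hc | hc
    · left; rw [soloInformed_aeval_zero_pderiv]; exact (map_ne_zero_iff _ e).2 hc
    · right; rw [soloInformed_aeval_zero_pderiv]; exact (map_ne_zero_iff _ e).2 hc
  exact soloInformed_locPresOn_smooth hK hKrc P D F h.isOpen h.isSemialgebraic one_pos
    (fun z hz _ hzf => h.frontier z hz hzf) hF0 hgrad hD

end Smooth

end Summit.KontsevichZagierPeriods.KontsevichZagierPeriods.Theorems
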